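import Summits.Ventures.WeilGRH.DualTrigCertMod19Class4Log5Half
import Summits.Ventures.WeilGRH.DualTrigCertMod19Class6Log5Half
import Summits.Ventures.WeilGRH.FrontierUniformBelowThirty
import Summits.Ventures.WeilGRH.MinorantZetaTransferOddRungs
import Literature.NumberTheory.LFunctions.WeilExplicitDirichletConj
import HarnessLib

/-!
# The ζ frontier `4023/5000` for every non-principal Dirichlet character mod 19

Cell `rh-explicit`, WEIL TRACK — GRH ARM, route B (weil-grh-3, gen14).  Assembly (no kernel work): `2` generates `(ℤ/19)ˣ` with
`2⁹ = −1`, so an EVEN character has `χ(2) = e(k/9)`.  `k = 0` is the principal character; `k = ±1`, `±2` are the census pairs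
`19.4`/`19.5` and `19.16`/`19.6`, certified by the format-D-K files `DualTrigCertMod19Class4Log5Half` / `…Class6Log5Half` (standard
rung `N = 4`, `t = (log 5)/2 ⊇ 4023/5000`); `k = ±3, ±4` have `Re χ(2) ≤ −1/2 ≤ −0.14` and are covered by the arm's uniform theorem
`weilPositivityOnChar_frontier_of_ge_nineteen_of_re_two_le` (`FrontierUniformBelowThirty`); the ODD characters of conductor 19 lie
above the odd uniform floor `14` (`weilPositivityOnChar_frontier_of_odd_ge_fourteen`).  Headline:
`weilPositivityOnChar_mod19_frontier_of_ne_one` — for EVERY Dirichlet character `χ ≠ 1` mod 19 and every smooth `g` supported in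
`[−4023/5000, 4023/5000]`, `Re W_χ(g ⋆ g̃) ≥ 0`: the first prime modulus below the all-character floor `30` completed at the ζ frontier.
Honest scope: these characters and this window only.  No named facts, no `sorry`; axioms standard.
-/

namespace Summit.Ventures.WeilGRH

open Literature.NumberTheory.LFunctions

/-- `exp (2πi/9)^k = exp (2πi·(k/9))`. [folklore] -/
theorem exp_ninth_pow (k : ℕ) :
    Complex.exp (2 * Real.pi * Complex.I / 9) ^ k = Complex.exp (2 * Real.pi * Complex.I * ((k : ℂ) / 9)) := by
  rw [← Complex.exp_nat_mul]; congr 1; ring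

/-- `Re e(1/3) ≤ −0.14` (`cos (2π/3) = −1/2`). [folklore] -/
theorem re_expPhase_three_ninths_le : (Complex.exp (2 * Real.pi * Complex.I * ((3 : ℕ) / 9))).re ≤ -0.14 := by
  have e : (2 * Real.pi * Complex.I * ((3 : ℕ) / 9) : ℂ) = ((Real.pi - Real.pi / 3 : ℝ) : ℂ) * Complex.I := by
    push_cast; ring
  rw [e, Complex.exp_ofReal_mul_I_re, Real.cos_pi_sub, Real.cos_pi_div_three]
  norm_num

/-- `Re e(4/9) ≤ −0.14` (`cos (8π/9) ≤ cos (2π/3) = −1/2`). [folklore] -/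
theorem re_expPhase_four_ninths_le : (Complex.exp (2 * Real.pi * Complex.I * ((4 : ℕ) / 9))).re ≤ -0.14 := by
  have e : (2 * Real.pi * Complex.I * ((4 : ℕ) / 9) : ℂ) = ((8 * Real.pi / 9 : ℝ) : ℂ) * Complex.I := by
    push_cast; ring
  rw [e, Complex.exp_ofReal_mul_I_re]
  have hle : Real.cos (8 * Real.pi / 9) ≤ Real.cos (Real.pi - Real.pi / 3) :=
    Real.cos_le_cos_of_nonneg_of_le_pi (by linarith [Real.pi_pos]) (by linarith [Real.pi_pos]) (by linarith [Real.pi_pos])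
  rw [Real.cos_pi_sub, Real.cos_pi_div_three] at hle
  linarith

/-- **The ζ frontier `4023/5000` for every non-principal EVEN Dirichlet character mod 19.**  `2` generates `(ℤ/19)ˣ` and `2⁹ = −1`,
so an even `χ` has `χ(2)⁹ = 1`, `χ(2) = e(k/9)`; `k = 0` is the principal character, `k = ±1` the census pair `19.4`/`19.5` and
`k = ±2` the pair `19.16`/`19.6` (format-D-K certificates `DualTrigCertMod19Class{4,6}Log5Half`), and `k = ±3, ±4` have
`Re χ(2) ≤ −1/2 ≤ −0.14` (`FrontierUniformBelowThirty`, `weilPositivityOnChar_frontier_of_ge_nineteen_of_re_two_le`). [folklore] -/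
theorem weilPositivityOnChar_mod19_frontier_of_even (χ : DirichletCharacter ℂ 19) (hχ : χ ≠ 1) (he : χ.Even) :
    WeilPositivityOnChar χ (4023 / 5000) := by
  have h9 : χ (2 : ZMod 19) ^ 9 = 1 := by
    rw [← map_pow, show (2 : ZMod 19) ^ 9 = -1 by decide]; exact he
  have hprim : IsPrimitiveRoot (Complex.exp (2 * Real.pi * Complex.I / 9)) 9 :=
    Complex.isPrimitiveRoot_exp 9 (by norm_num)
  obtain ⟨k, hk, hζ⟩ := hprim.eq_pow_of_pow_eq_one h9
  rw [exp_ninth_pow] at hζ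
  -- the inverse character has `χ⁻¹(2) = e((9 − k)/9)`
  have hinv : ∀ m : ℕ, (m : ℂ) + k = 9 → χ⁻¹ (2 : ZMod 19) = Complex.exp (2 * Real.pi * Complex.I * ((m : ℂ) / 9)) := by
    intro m hm
    rw [MulChar.inv_apply_eq_inv', ← hζ, ← Complex.exp_neg, Complex.exp_eq_exp_iff_exists_int]
    refine ⟨-1, ?_⟩
    have : (k : ℂ) = 9 - m := by rw [← hm]; ring
    rw [this]; push_cast; ring
  have below : ∀ ψ : DirichletCharacter ℂ 19, (ψ (2 : ZMod 19)).re ≤ -0.14 → WeilPositivityOnChar ψ (4023 / 5000) :=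
    fun ψ h ↦ weilPositivityOnChar_frontier_of_ge_nineteen_of_re_two_le (le_refl 19) ψ h
  interval_cases k
  · -- `χ(2) = 1` forces `χ = 1`
    exfalso; apply hχ
    apply MulChar.ext
    intro a
    haveI : Fact (1 < 19) := ⟨by norm_num⟩
    have key : ∀ x : ZMod 19, x ≠ 0 → ∃ j : ℕ, j < 18 ∧ (2 : ZMod 19) ^ j = x := by decide
    obtain ⟨j, -, hj⟩ := key (a : ZMod 19) a.ne_zero
    have h2 : χ (2 : ZMod 19) = 1 := by rw [← hζ]; push_cast; simp
    have ha : χ (a : ZMod 19) = 1 := by rw [← hj, map_pow, h2, one_pow]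
    rw [ha, MulChar.one_apply_coe]
  · exact weilPositivityOnChar_mod19_class4_frontier χ (by rw [← hζ]; push_cast; ring_nf)
  · exact weilPositivityOnChar_mod19_class6_frontier_conj χ (by rw [← hζ]; push_cast; ring_nf)
  · exact below χ (by rw [← hζ]; exact re_expPhase_three_ninths_le)
  · exact below χ (by rw [← hζ]; exact re_expPhase_four_ninths_le)
  · exact (weilPositivityOnChar_inv_iff χ (4023 / 5000)).1 (below χ⁻¹ (by rw [hinv 4 (by norm_num)]; exact re_expPhase_four_ninths_le))
  · exact (weilPositivityOnChar_inv_iff χ (4023 / 5000)).1 (below χ⁻¹ (by rw [hinv 3 (by norm_num)]; exact re_expPhase_three_ninths_le))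
  · refine weilPositivityOnChar_mod19_class6_frontier χ ?_
    rw [← hζ, Complex.exp_eq_exp_iff_exists_int]
    exact ⟨1, by push_cast; ring⟩
  · refine weilPositivityOnChar_mod19_class4_frontier_conj χ ?_
    rw [← hζ, Complex.exp_eq_exp_iff_exists_int]
    exact ⟨1, by push_cast; ring⟩

/-- **The ζ frontier `4023/5000` for every non-principal Dirichlet character mod 19** (odd: the arm's uniform odd floor `14`,
`weilPositivityOnChar_frontier_of_odd_ge_fourteen`; even: the theorem above). [folklore] -/
theorem weilPositivityOnChar_mod19_frontier_of_ne_one (χ : DirichletCharacter ℂ 19) (hχ : χ ≠ 1) :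
    WeilPositivityOnChar χ (4023 / 5000) := by
  rcases χ.even_or_odd with he | ho
  · exact weilPositivityOnChar_mod19_frontier_of_even χ hχ he
  · exact weilPositivityOnChar_frontier_of_odd_ge_fourteen (by norm_num) χ (charParity_of_odd ho)

end Summit.Ventures.WeilGRH
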